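import Mathlib

/-!
# Abstract kernel theorem for Beta-symbol relators (drefute evidence for `stub_kernel`, line koblitz-ogus-halving)

Representation-free form: for ANY abelian group `G` with symbols `sym : ℚ → ℚ → G`, a subgroup `Rel`
containing symmetry, translation-by-one and Dirichlet relators on level-`D` positive symbols, and an
additive class map `cl : G →+ (ZMod D → ℤ)` with `cl (sym (i/D) (j/D)) = e_i + e_j − e_{i+j}`,
every `v` in the subgroup generated by the level-`D` positive symbols with `cl v = 0` lies in `Rel`.
Constructive: Dirichlet descent to the basis symbols `(x̂/D, 1/D)` + linear independence of their
class vectors `u_x = e_x + e_1 − e_{x+1}`.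

MAIN RESULT (all arguments explicit, `qD D n := n / D`):
```
DrefuteKernel.mem_of_cl_eq_zero
  (sym : ℚ → ℚ → G) (Rel : AddSubgroup G) (cl : G →+ (ZMod D → ℤ))
  (hsymm : ∀ i j : ℕ, 0 < i → 0 < j → sym (qD D i) (qD D j) - sym (qD D j) (qD D i) ∈ Rel)
  (htrans : ∀ i j : ℕ, 0 < i → 0 < j → sym (qD D i) (qD D j) - sym (qD D (i + D)) (qD D j) ∈ Rel)   -- a ↦ a+1
  (hdir : ∀ i j l : ℕ, 0 < i → 0 < j → 0 < l →
     sym (qD D i) (qD D j) + sym (qD D (i + j)) (qD D l) - sym (qD D j) (qD D l) - sym (qD D i) (qD D (j + l)) ∈ Rel)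
  (hcl : ∀ i j : ℕ, 0 < i → 0 < j → cl (sym (qD D i) (qD D j)) = e i + e j - e (i + j))
  (v : G) (hv : v ∈ AddSubgroup.closure {g | ∃ i j : ℕ, 0 < i ∧ 0 < j ∧ g = sym (qD D i) (qD D j)}) (h0 : cl v = 0) :
  v ∈ Rel
```
INSTANTIATION for `stub_kernel (D) (v : BSym) (hv : v ∈ levelSym D) (h0 : clD D v = 0) : v ∈ RelSpan`:
`G := BSym`, `sym := bsym`, `Rel := RelSpan`, `cl := clD D`; `hsymm/htrans/hdir` are the symmetry /
translation (`bsym a b − bsym (a+1) b`, note `qD D (i + D) = qD D i + 1`) / Dirichlet generators of `RelSpan`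
restricted to level-`D` positive entries (`push_cast [qD]; ring_nf` converts), `hcl` is the defining formula of
`clD` on a symbol (class of `n/D` in `ZMod D` is `n`), and `levelSym D ≤ closure gens` holds iff `levelSym`
only contains symbols with POSITIVE level-`D` entries (a positive rational `a` with `a.den ∣ D` is
`qD D (a * D).num.toNat`). If `levelSym D` admits a non-positive entry the stub is FALSE instead (junk symbol
outside every relator) — see the drefute summary note. Only symmetry, translation and Dirichlet relators are
used: reflection / multiplication / unit relators in `RelSpan` are not needed for the kernel statement.
-/

namespace DrefuteKernel

open Finset

variable {D : ℕ} [NeZero D]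

/-! ## Class vectors -/

/-- indicator `e_a` -/
def e (a : ZMod D) : ZMod D → ℤ := fun x => if x = a then 1 else 0

/-- `u_x := e_x + e_1 − e_{x+1}` -/
def u (x : ZMod D) : ZMod D → ℤ := e x + e 1 - e (x + 1)

theorem sum_smul_u_apply (c : ZMod D → ℤ) (y : ZMod D) :
    (∑ x, c x • u x) y = c y + (if y = 1 then ∑ x, c x else 0) - c (y - 1) := by
  simp only [Finset.sum_apply, Pi.smul_apply, smul_eq_mul, u, e, Pi.add_apply, Pi.sub_apply,
    mul_add, mul_sub, Finset.sum_add_distrib, Finset.sum_sub_distrib]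
  congr 1
  · congr 1
    · rw [Finset.sum_eq_single y]
      · simp
      · intro b _ hb; simp [Ne.symm hb]
      · simp
    · split_ifs with h
      · exact Finset.sum_congr rfl fun x _ => by simp
      · exact Finset.sum_eq_zero fun x _ => by simp
  · rw [Finset.sum_eq_single (y - 1)]
    · simp
    · intro b _ hb
      have : y ≠ b + 1 := by intro h'; exact hb (by rw [h']; ring)
      simp [this]
    · simp

/-- Linear independence of the `u_x`. -/
theorem eq_zero_of_sum_smul_u (c : ZMod D → ℤ) (h : ∑ x, c x • u x = 0) : c = 0 := by
  have hy : ∀ y, c y + (if y = 1 then ∑ x, c x else 0) - c (y - 1) = 0 := fun y => by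
    rw [← sum_smul_u_apply, h]; rfl
  have hsum : ∑ x, c x = 0 := by
    have := Finset.sum_eq_zero (s := Finset.univ) (fun y _ => hy y)
    simp only [Finset.sum_sub_distrib, Finset.sum_add_distrib, Finset.sum_ite_eq', Finset.mem_univ,
      if_true] at this
    have hre : ∑ y : ZMod D, c (y - 1) = ∑ y, c y :=
      Fintype.sum_equiv (Equiv.subRight 1) _ _ fun _ => rfl
    rw [hre] at this
    linarith
  have hstep : ∀ y, c y = c (y - 1) := fun y => by
    have := hy y; rw [hsum] at this; simp at this; linarith
  have hconst : ∀ n : ℕ, c (n : ZMod D) = c 0 := by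
    intro n
    induction n with
    | zero => simp
    | succ n ih => rw [← ih, hstep (↑(n + 1))]; push_cast; ring_nf
  have hc0 : ∀ y, c y = c 0 := fun y => by
    rw [← ZMod.natCast_zmod_val y]; exact hconst _
  have : (D : ℤ) * c 0 = 0 := by
    rw [← hsum, Finset.sum_congr rfl fun y _ => hc0 y]
    simp [Finset.sum_const, Finset.card_univ, ZMod.card]
  have hc00 : c 0 = 0 := by
    rcases mul_eq_zero.mp this with h0 | h0
    · exact absurd (by exact_mod_cast h0) (NeZero.ne D)
    · exact h0
  funext y; rw [hc0 y, hc00]; rfl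

omit [NeZero D] in
theorem u_zero : u (0 : ZMod D) = e 0 := by
  funext y; simp [u, e]

/-- `F a k := e_a + e_k − e_{a+k}`, the class vector of the symbol `(a/D, k/D)`. -/
def F (a : ZMod D) (k : ℕ) : ZMod D → ℤ := e a + e (k : ZMod D) - e (a + (k : ZMod D))

omit [NeZero D] in
theorem F_succ (a : ZMod D) (k : ℕ) : F a (k + 1) = F a k + u (a + (k : ZMod D)) - u (k : ZMod D) := by
  funext y
  simp only [F, u, e, Pi.add_apply, Pi.sub_apply, Nat.cast_succ]
  have h1 : a + ((k : ZMod D) + 1) = a + (k : ZMod D) + 1 := by ring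
  rw [h1]
  ring

omit [NeZero D] in
theorem F_expand (a : ZMod D) (k : ℕ) :
    F a k = u 0 + ∑ j ∈ Finset.range k, (u (a + (j : ZMod D)) - u (j : ZMod D)) := by
  induction k with
  | zero =>
    rw [Finset.range_zero, Finset.sum_empty, add_zero, u_zero]
    funext y; simp [F, e]
  | succ k ih => rw [F_succ, ih, Finset.sum_range_succ]; abel

/-! ## Canonical lifts -/

/-- canonical lift of a class to `[1, D]` -/
def liftN (x : ZMod D) : ℕ := if x = 0 then D else x.val

theorem liftN_pos (x : ZMod D) : 0 < liftN x := by
  unfold liftN; split_ifs with h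
  · exact Nat.pos_of_ne_zero (NeZero.ne D)
  · exact Nat.pos_of_ne_zero fun h0 => h ((ZMod.val_eq_zero x).mp h0)

theorem liftN_le (x : ZMod D) : liftN x ≤ D := by
  unfold liftN; split_ifs with h
  · exact le_rfl
  · exact (ZMod.val_lt x).le

theorem cast_liftN (x : ZMod D) : ((liftN x : ℕ) : ZMod D) = x := by
  unfold liftN; split_ifs with h
  · rw [h, ZMod.natCast_self]
  · exact ZMod.natCast_zmod_val x

theorem liftN_natCast {n : ℕ} (h1 : 1 ≤ n) (h2 : n ≤ D) : liftN (n : ZMod D) = n := by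
  unfold liftN
  rcases h2.lt_or_eq with hlt | heq
  · have hne : (n : ZMod D) ≠ 0 := by
      rw [Ne, ZMod.natCast_eq_zero_iff]
      exact Nat.not_dvd_of_pos_of_lt h1 hlt
    rw [if_neg hne, ZMod.val_natCast, Nat.mod_eq_of_lt hlt]
  · subst heq; rw [ZMod.natCast_self, if_pos rfl]

/-! ## The abstract setting -/

section Setting

variable {G : Type*} [AddCommGroup G]
variable (D)

/-- level-`D` rational with numerator `n`: `n / D` -/
def qD (n : ℕ) : ℚ := (n : ℚ) / D

variable {D}
variable (sym : ℚ → ℚ → G) (Rel : AddSubgroup G) (cl : G →+ (ZMod D → ℤ))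

/-- basis symbols `S x = sym (x̂/D) (1/D)` -/
def S (x : ZMod D) : G := sym (qD D (liftN x)) (qD D 1)

/-- the level-`D` positive symbols -/
def gens : Set G := {g | ∃ i j : ℕ, 0 < i ∧ 0 < j ∧ g = sym (qD D i) (qD D j)}

/-- `Φ c = Σ c_x • S_x` -/
def Φ : (ZMod D → ℤ) →+ G where
  toFun c := ∑ x, c x • S sym x
  map_zero' := by simp
  map_add' c c' := by simp_rw [Pi.add_apply, add_smul, Finset.sum_add_distrib]

/-- `Ψ c = Σ c_x • u_x` -/
def Ψ : (ZMod D → ℤ) →+ (ZMod D → ℤ) where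
  toFun c := ∑ x, c x • u x
  map_zero' := by simp
  map_add' c c' := by simp_rw [Pi.add_apply, add_smul, Finset.sum_add_distrib]

theorem Φ_single (a : ZMod D) : Φ sym (Pi.single a 1) = S sym a := by
  simp [Φ, Pi.single_apply]

theorem Ψ_single (a : ZMod D) : Ψ (D := D) (Pi.single a 1) = u a := by
  simp [Ψ, Pi.single_apply]

/-- the invariant: `v ≡ Φ c (mod Rel)` and `cl v = Ψ c` for some coefficient vector `c` -/
def P (v : G) : Prop := ∃ c : ZMod D → ℤ, v - Φ sym c ∈ Rel ∧ cl v = Ψ c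

variable (hsymm : ∀ i j : ℕ, 0 < i → 0 < j → sym (qD D i) (qD D j) - sym (qD D j) (qD D i) ∈ Rel)
variable (htrans : ∀ i j : ℕ, 0 < i → 0 < j → sym (qD D i) (qD D j) - sym (qD D (i + D)) (qD D j) ∈ Rel)
variable (hdir : ∀ i j l : ℕ, 0 < i → 0 < j → 0 < l →
  sym (qD D i) (qD D j) + sym (qD D (i + j)) (qD D l) - sym (qD D j) (qD D l) - sym (qD D i) (qD D (j + l)) ∈ Rel)
variable (hcl : ∀ i j : ℕ, 0 < i → 0 < j →
  cl (sym (qD D i) (qD D j)) = e (i : ZMod D) + e (j : ZMod D) - e ((i + j : ℕ) : ZMod D))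

omit [NeZero D] in
include htrans in
/-- iterated translation in the first slot -/
theorem trans_iter (i j m : ℕ) (hi : 0 < i) (hj : 0 < j) :
    sym (qD D i) (qD D j) - sym (qD D (i + m * D)) (qD D j) ∈ Rel := by
  induction m with
  | zero => simp
  | succ m ih =>
    have h2 := htrans (i + m * D) j (by omega) hj
    have : i + (m + 1) * D = i + m * D + D := by ring
    rw [this]
    have := Rel.add_mem ih h2
    simpa using this

omit [NeZero D] in
include hsymm htrans in
/-- iterated translation in the second slot -/
theorem trans_iter' (i j m : ℕ) (hi : 0 < i) (hj : 0 < j) :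
    sym (qD D i) (qD D j) - sym (qD D i) (qD D (j + m * D)) ∈ Rel := by
  have h1 := hsymm i j hi hj
  have h2 := trans_iter sym Rel htrans j i m hj hi
  have h3 := hsymm (j + m * D) i (by omega) hi
  have := Rel.add_mem (Rel.add_mem h1 h2) h3
  convert this using 1; abel

include htrans in
/-- the symbol `(n/D, 1/D)` for `1 ≤ n ≤ 2D − 1` is the basis symbol `S (n mod D)` modulo `Rel` -/
theorem sym_sub_S_mem (n : ℕ) (h1 : 1 ≤ n) (h2 : n < 2 * D) :
    sym (qD D n) (qD D 1) - S sym (n : ZMod D) ∈ Rel := by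
  unfold S
  rcases le_or_gt n D with hle | hlt
  · rw [liftN_natCast h1 hle, sub_self]; exact Rel.zero_mem
  · -- n = (n - D) + D with 1 ≤ n - D ≤ D
    have hnD : liftN (n : ZMod D) = n - D := by
      have hc : ((n - D : ℕ) : ZMod D) = (n : ZMod D) := by
        have : n = (n - D) + D := by omega
        conv_rhs => rw [this]
        push_cast; simp
      rw [← hc]; exact liftN_natCast (by omega) (by omega)
    rw [hnD]
    have h := htrans (n - D) 1 (by omega) Nat.one_pos
    have hn : n - D + D = n := by omega
    rw [hn] at h
    have := Rel.neg_mem h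
    simpa using this

include htrans hdir in
/-- Dirichlet descent: `sym (i/D) (k/D) ≡ S 0 + Σ_{j<k} (S(i+j) − S j)` for `1 ≤ i ≤ D`, `1 ≤ k ≤ D` -/
theorem descent (i : ℕ) (hi1 : 1 ≤ i) (hiD : i ≤ D) (k : ℕ) (hk1 : 1 ≤ k) (hkD : k ≤ D) :
    sym (qD D i) (qD D k) - (S sym (0 : ZMod D) + ∑ j ∈ Finset.range k, (S sym ((i + j : ℕ) : ZMod D) - S sym (j : ZMod D))) ∈ Rel := by
  induction k with
  | zero => omega
  | succ k ih =>
    rcases Nat.eq_zero_or_pos k with hk0 | hkpos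
    · subst hk0
      simp only [zero_add, Finset.range_one, Finset.sum_singleton, Nat.cast_zero, add_zero]
      have h := sym_sub_S_mem sym Rel htrans i hi1 (by omega)
      have : sym (qD D i) (qD D 1) - (S sym (0 : ZMod D) + (S sym (i : ZMod D) - S sym (0 : ZMod D))) =
          sym (qD D i) (qD D 1) - S sym (i : ZMod D) := by abel
      rw [this]; exact h
    · have ih' := ih hkpos (by omega)
      -- Dirichlet relator at (i, k, 1)
      have hd := hdir i k 1 (by omega) hkpos Nat.one_pos
      have hA := sym_sub_S_mem sym Rel htrans (i + k) (by omega) (by omega)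
      have hB := sym_sub_S_mem sym Rel htrans k hkpos (by omega)
      rw [Finset.sum_range_succ]
      -- combine: target = ih' - hd + hA - hB  (as group elements)
      have := Rel.sub_mem (Rel.add_mem (Rel.sub_mem ih' hd) hA) hB
      convert this using 1
      push_cast
      abel

include hsymm htrans hdir hcl in
/-- generators satisfy the invariant -/
theorem P_gen (i j : ℕ) (hi : 0 < i) (hj : 0 < j) : P sym Rel cl (sym (qD D i) (qD D j)) := by
  -- reduce `i`, `j` to `î, ĵ ∈ [1, D]`
  obtain ⟨mi, î, hî1, hîD, hi_eq⟩ : ∃ m r : ℕ, 1 ≤ r ∧ r ≤ D ∧ i = r + m * D :=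
    ⟨(i - 1) / D, (i - 1) % D + 1, by omega,
      Nat.succ_le_of_lt (Nat.mod_lt _ (Nat.pos_of_ne_zero (NeZero.ne D))), by
        have := Nat.div_add_mod (i - 1) D; rw [Nat.mul_comm] at this; omega⟩
  obtain ⟨mj, ĵ, hĵ1, hĵD, hj_eq⟩ : ∃ m r : ℕ, 1 ≤ r ∧ r ≤ D ∧ j = r + m * D :=
    ⟨(j - 1) / D, (j - 1) % D + 1, by omega,
      Nat.succ_le_of_lt (Nat.mod_lt _ (Nat.pos_of_ne_zero (NeZero.ne D))), by
        have := Nat.div_add_mod (j - 1) D; rw [Nat.mul_comm] at this; omega⟩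
  -- the coefficient vector
  let c : ZMod D → ℤ :=
    Pi.single 0 1 + ∑ l ∈ Finset.range ĵ, (Pi.single (((î + l : ℕ) : ZMod D)) 1 - Pi.single ((l : ℕ) : ZMod D) 1)
  refine ⟨c, ?_, ?_⟩
  · -- v ≡ sym (î/D) (ĵ/D) ≡ Φ c
    have h1 : sym (qD D i) (qD D j) - sym (qD D î) (qD D ĵ) ∈ Rel := by
      have ha := trans_iter sym Rel htrans î j mi hî1 hj
      have hb := trans_iter' sym Rel hsymm htrans î ĵ mj hî1 hĵ1
      rw [← hi_eq] at ha; rw [← hj_eq] at hb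
      have := Rel.neg_mem (Rel.add_mem ha hb)
      convert this using 1; abel
    have h2 := descent sym Rel htrans hdir î hî1 hîD ĵ hĵ1 hĵD
    have hΦ : Φ sym c = S sym (0 : ZMod D) +
        ∑ l ∈ Finset.range ĵ, (S sym ((î + l : ℕ) : ZMod D) - S sym (l : ZMod D)) := by
      simp only [c, map_add, map_sum, map_sub, Φ_single]
    rw [hΦ]
    have := Rel.add_mem h1 h2
    convert this using 1; abel
  · -- cl v = F î ĵ = Ψ c
    have hcast_i : ((i : ℕ) : ZMod D) = (î : ZMod D) := by rw [hi_eq]; push_cast; simp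
    have hcast_j : ((j : ℕ) : ZMod D) = (ĵ : ZMod D) := by rw [hj_eq]; push_cast; simp
    have hF : cl (sym (qD D i) (qD D j)) = F (î : ZMod D) ĵ := by
      rw [hcl i j hi hj, F, Nat.cast_add, hcast_i, hcast_j]
    have hΨ : Ψ c = u 0 + ∑ l ∈ Finset.range ĵ, (u ((î : ZMod D) + (l : ZMod D)) - u (l : ZMod D)) := by
      simp only [c, map_add, map_sum, map_sub, Ψ_single, Nat.cast_add]
    rw [hF, hΨ, F_expand]

include hsymm htrans hdir hcl in
/-- **Abstract kernel theorem.** -/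
theorem mem_of_cl_eq_zero (v : G) (hv : v ∈ AddSubgroup.closure (gens (D := D) sym)) (h0 : cl v = 0) :
    v ∈ Rel := by
  have hP : P sym Rel cl v := by
    refine AddSubgroup.closure_induction (p := fun w _ => P sym Rel cl w) ?_ ?_ ?_ ?_ hv
    · rintro g ⟨i, j, hi, hj, rfl⟩
      exact P_gen sym Rel cl hsymm htrans hdir hcl i j hi hj
    · exact ⟨0, by simp, by simp⟩
    · rintro x y _ _ ⟨cx, hx1, hx2⟩ ⟨cy, hy1, hy2⟩
      refine ⟨cx + cy, ?_, ?_⟩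
      · rw [map_add]
        have := Rel.add_mem hx1 hy1
        convert this using 1; abel
      · rw [map_add, map_add, hx2, hy2]
    · rintro x _ ⟨cx, hx1, hx2⟩
      refine ⟨-cx, ?_, ?_⟩
      · rw [map_neg]
        have := Rel.neg_mem hx1
        convert this using 1; abel
      · rw [map_neg, map_neg, hx2]
  obtain ⟨c, hc1, hc2⟩ := hP
  have hc : c = 0 := by
    apply eq_zero_of_sum_smul_u
    have : Ψ c = 0 := by rw [← hc2, h0]
    exact this
  rw [hc, map_zero, sub_zero] at hc1
  exact hc1

/-! ## The total-class functional (parity tool for `stub_spanLift`) -/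

/-- `λ f := Σ_x f(x) • x ∈ ZMod D` -/
def lam : (ZMod D → ℤ) →+ ZMod D where
  toFun f := ∑ x, f x • x
  map_zero' := by simp
  map_add' f g := by simp_rw [Pi.add_apply, add_smul, Finset.sum_add_distrib]

theorem lam_e (a : ZMod D) : lam (e a) = a := by
  simp [lam, e]

include hcl in
/-- **Every class vector has total class `0`**: `λ (cl v) = 0` for `v` in the span of level-`D`
positive symbols. (So a vector with an odd coefficient sum against `x` — e.g. `e_{D/2}` for even `D`,
the order-2 distribution vector at `0` — is never a class vector: this is the parity bookkeeping behind
the `2 ∣ D` / `hrange` hypotheses of `stub_spanLift`.) -/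
theorem lam_cl_eq_zero (v : G) (hv : v ∈ AddSubgroup.closure (gens (D := D) sym)) : lam (cl v) = 0 := by
  refine AddSubgroup.closure_induction (p := fun w _ => lam (cl w) = 0) ?_ ?_ ?_ ?_ hv
  · rintro g ⟨i, j, hi, hj, rfl⟩
    rw [hcl i j hi hj, map_sub, map_add, lam_e, lam_e, lam_e]
    push_cast; ring
  · simp
  · intro x y _ _ hx hy; rw [map_add, map_add, hx, hy, add_zero]
  · intro x _ hx; rw [map_neg, map_neg, hx, neg_zero]

end Setting

end DrefuteKernel
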